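import Mathlib
import Summits.ResolutionOfSingularities.ResolutionOfSingularities.Theorems.WeightedInvariantIotaOrderConeSpecimen
import HarnessLib

/-!
# Kernel specimen, part 2: the order of `x` along the ruling of the quadric cone is EXACTLY two, and the generic
# «order-like `ι`» form of the failure of the all-rings generization clause (door `HypersurfaceCentreConstruction`,
# stmt-ResolutionOfSingularities-19897, route `WeightedInvariant`; design point (c7) of `…HypersurfaceLocalGameEFT3`)

[OURS · L1 W4.3 · cell `res-hironaka`, HUMAN RULING D-0089] Helper file `--supports stmt-ResolutionOfSingularities-19897`,
companion of `…IotaOrderConeSpecimen` (p502972) — KERNEL DOCUMENTATION OF A DESIGN POINT only.  No statement of the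
manuscript under review (Hironaka 2017) is typed or used here, nothing is attributed to its author, and nothing here is a
claim about resolution of singularities.  AI-produced, weaker than expert review.  Typer: res-type-097 (reserve volunteer).

CONTENT.  With `A = k[x,y,z]/(xy − z²)`, ruling `𝔭`, vertex `𝔪`, `S = A_𝔪` (`VertexLocalRing`), `𝔭' = 𝔭A_𝔪`
(`rulingAtVertex`) as in part 1:
* `x ∉ 𝔪((A_𝔪)_{𝔭'})³` (`x_not_mem_cube_atRulingAtVertex`) — the `k`-algebra test map `A → k(T)⟦ε⟧`, `x ↦ T⁻¹ε²`,
  `y ↦ T`, `z ↦ ε` kills `xy − z²`, sends `A ∖ 𝔭` to units (constant coefficient = the ruling value under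
  `k[T] ↪ k(T)`) and `𝔭` into `(ε)`; it extends to `(A_𝔪)_{𝔭'}` (an `A`-localization at `𝔭`,
  `isLocalizationAtPrime_rulingGen`) and sends `𝔪³` into `(ε³) ∌ T⁻¹ε²`;
* hence `iotaOrd ((A_𝔪)_{𝔭'}) x = 2` exactly (`iotaOrd_x_atRulingAtVertex`; part 1 has `iotaOrd (A_𝔪) x = 1`);
* `not_generizationMonotone_of_orderLike`: for EVERY class function `ι : (R : Type) → [CommRing R] → R → Ordinal`
  that agrees with the `𝔪`-adic order wherever that order is finite (`g ∈ 𝔪ⁿ ∖ 𝔪ⁿ⁺¹ ⇒ ι R g = n` at local rings; any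
  junk elsewhere — `iotaOrd`, and any future refinement whose value on finite-order germs is the order), the ALL-RINGS
  form of the generization clause fails (`S = A_𝔪` over `ℚ`): the `[IsRegularLocalRing S]` hypothesis of the tree's
  (c7) `IotaGenerizationMonotone` cannot be dropped for any such `ι`.
-/

noncomputable section

set_option linter.dupNamespace false -- mandated namespace `Summit.<Summit>.<Problem>` of this single-conjunct summit

open IsLocalRing MvPolynomial

namespace Summit.ResolutionOfSingularities.ResolutionOfSingularities.Cruxes.HypersurfaceCentreConstruction.LocalEngine.ConeSpecimen

variable (k : Type) [Field k]

section OrderTwoAtRuling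

/-! ### The order of `x` at the ruling is EXACTLY two: a test map to `k(T)⟦ε⟧` -/

/-- [OURS] The test ring `E = k(T)⟦ε⟧` (a local ring; `T` stands for the unit `y`, `ε` for the uniformiser `z`). -/
abbrev E : Type := PowerSeries (RatFunc k)

/-- [OURS] `T ∈ k(T)`. -/
def tK : RatFunc k := algebraMap (Polynomial k) (RatFunc k) Polynomial.X

/-- `T ≠ 0`. -/
theorem tK_ne_zero : tK k ≠ 0 := by
  intro h
  have h' : (Polynomial.X : Polynomial k) = 0 :=
    RatFunc.algebraMap_injective k (by rw [map_zero]; exact h)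
  exact Polynomial.X_ne_zero h'

/-- [OURS] The test map `k[X₀,X₁,X₂] → k(T)⟦ε⟧`: `X₀ ↦ T⁻¹ε²`, `X₁ ↦ T`, `X₂ ↦ ε`. -/
def toSeriesPoly : MvPolynomial (Fin 3) k →ₐ[k] E k :=
  MvPolynomial.aeval ![PowerSeries.C (tK k)⁻¹ * PowerSeries.X ^ 2, PowerSeries.C (tK k), PowerSeries.X]

/-- The test map kills the cone relation: `T⁻¹ε²·T − ε² = 0`. -/
theorem toSeriesPoly_coneRel : toSeriesPoly k (coneRel k) = 0 := by
  have h : PowerSeries.C (tK k)⁻¹ * PowerSeries.C (tK k) = (1 : E k) := by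
    rw [← map_mul, inv_mul_cancel₀ (tK_ne_zero k), map_one]
  simp only [toSeriesPoly, coneRel, map_sub, map_mul, map_pow, MvPolynomial.aeval_X,
    Matrix.cons_val_zero, Matrix.cons_val_one, Matrix.cons_val_two, Matrix.head_cons, Matrix.tail_cons]
  linear_combination (PowerSeries.X ^ 2 : E k) * h

/-- [OURS] The test map on the cone ring `A → k(T)⟦ε⟧`, `x ↦ T⁻¹ε²`, `y ↦ T`, `z ↦ ε`. -/
def toSeries : ConeRing k →ₐ[k] E k :=
  Ideal.Quotient.liftₐ (Ideal.span {coneRel k}) (toSeriesPoly k) (by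
    intro a ha
    obtain ⟨c, rfl⟩ := Ideal.mem_span_singleton'.mp ha
    rw [map_mul, toSeriesPoly_coneRel, mul_zero])

/-- `x ↦ T⁻¹ε²`. -/
@[simp] theorem toSeries_x : toSeries k (x k) = PowerSeries.C (tK k)⁻¹ * PowerSeries.X ^ 2 := by
  simp [toSeries, toSeriesPoly, x]

/-- Constant coefficients of the test map are the ruling values: `constantCoeff ∘ toSeries = (k[T] ↪ k(T)) ∘ rulingHom`. -/
theorem constantCoeff_comp_toSeries :
    (PowerSeries.constantCoeff (R := RatFunc k)).comp (toSeries k).toRingHom =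
      (algebraMap (Polynomial k) (RatFunc k)).comp (rulingHom k).toRingHom := by
  apply Ideal.Quotient.ringHom_ext
  apply MvPolynomial.ringHom_ext
  · intro a
    simp [toSeries, toSeriesPoly, rulingHom, PowerSeries.algebraMap_apply, ← RatFunc.algebraMap_eq_C]
  · intro i
    fin_cases i <;> simp [toSeries, toSeriesPoly, rulingHom, tK]

/-- Pointwise form of `constantCoeff_comp_toSeries`. -/
theorem constantCoeff_toSeries (a : ConeRing k) :
    PowerSeries.constantCoeff (toSeries k a) = algebraMap (Polynomial k) (RatFunc k) (rulingHom k a) := by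
  have h := congrArg (fun φ : ConeRing k →+* RatFunc k => φ a) (constantCoeff_comp_toSeries k)
  simpa using h

/-- Elements off the ruling go to units of `k(T)⟦ε⟧` (their constant coefficient is a nonzero element of `k(T)`). -/
theorem isUnit_toSeries {s : ConeRing k} (hs : s ∉ ruling k) : IsUnit (toSeries k s) := by
  rw [PowerSeries.isUnit_iff_constantCoeff, constantCoeff_toSeries, isUnit_iff_ne_zero]
  intro h0
  apply hs
  have h1 : rulingHom k s = 0 := RatFunc.algebraMap_injective k (by rw [map_zero]; exact h0)
  simpa [ruling, RingHom.mem_ker] using h1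

/-- The ruling prime goes into `(ε)`. -/
theorem toSeries_mem_span_X {a : ConeRing k} (ha : a ∈ ruling k) :
    (toSeries k).toRingHom a ∈ Ideal.span {(PowerSeries.X : E k)} := by
  rw [Ideal.mem_span_singleton, AlgHom.toRingHom_eq_coe, RingHom.coe_coe, PowerSeries.X_dvd_iff,
    constantCoeff_toSeries]
  have ha' : rulingHom k a = 0 := by simpa [ruling, RingHom.mem_ker] using ha
  rw [ha', map_zero]

/-- `𝔭'` contracts to `𝔭` (comap form). -/
theorem comap_rulingAtVertex :
    Ideal.comap (algebraMap (ConeRing k) (VertexLocalRing k)) (rulingAtVertex k) = ruling k :=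
  under_rulingAtVertex k

/-- `(A_𝔪)_{𝔭'}` is a localization of `A` at (the contraction of) `𝔭'`, i.e. it is `A_𝔭`. -/
instance isLocalizationAtPrime_rulingGen :
    IsLocalization.AtPrime (Localization.AtPrime (rulingAtVertex k))
      (Ideal.comap (algebraMap (ConeRing k) (VertexLocalRing k)) (rulingAtVertex k)) :=
  IsLocalization.isLocalization_isLocalization_atPrime_isLocalization (vertex k).primeCompl
    (Localization.AtPrime (rulingAtVertex k)) (rulingAtVertex k)

/-- [OURS] The test map extended to `(A_𝔪)_{𝔭'} = A_𝔭` (elements off `𝔭` became units). -/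
def toSeriesGen : Localization.AtPrime (rulingAtVertex k) →+* E k :=
  IsLocalization.lift
    (M := (Ideal.comap (algebraMap (ConeRing k) (VertexLocalRing k)) (rulingAtVertex k)).primeCompl)
    (g := (toSeries k).toRingHom)
    (fun s => isUnit_toSeries k (fun h => Ideal.mem_primeCompl_iff.mp s.2 ((comap_rulingAtVertex k).ge h)))

/-- `toSeriesGen` extends `toSeries`. -/
theorem toSeriesGen_comp :
    (toSeriesGen k).comp (algebraMap (ConeRing k) (Localization.AtPrime (rulingAtVertex k))) =
      (toSeries k).toRingHom :=
  IsLocalization.lift_comp _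

/-- ORDER EXACTLY TWO ALONG THE RULING (upper bound): `x ∉ 𝔪_{(A_𝔪)_{𝔭'}}³` — under the extended test map the
maximal ideal goes into `(ε)`, so its cube goes into `(ε³)`, while `x ↦ T⁻¹ε²` has a nonzero `ε²`-coefficient. -/
theorem x_not_mem_cube_atRulingAtVertex :
    algebraMap (VertexLocalRing k) (Localization.AtPrime (rulingAtVertex k))
        (algebraMap (ConeRing k) (VertexLocalRing k) (x k)) ∉
      (maximalIdeal (Localization.AtPrime (rulingAtVertex k))) ^ 3 := by
  set T := Localization.AtPrime (rulingAtVertex k)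
  set I := Ideal.comap (algebraMap (ConeRing k) (VertexLocalRing k)) (rulingAtVertex k) with hI
  intro hx
  rw [← IsScalarTower.algebraMap_apply] at hx
  have hmax : maximalIdeal T = I.map (algebraMap (ConeRing k) T) := by
    have h := IsLocalization.AtPrime.under_maximalIdeal T I
    rw [← h, IsLocalization.map_under I.primeCompl T]
  rw [hmax, ← Ideal.map_pow] at hx
  have h1 : toSeriesGen k (algebraMap (ConeRing k) T (x k)) ∈
      (I ^ 3).map ((toSeriesGen k).comp (algebraMap (ConeRing k) T)) := by
    rw [← Ideal.map_map]
    exact Ideal.mem_map_of_mem _ hx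
  rw [← RingHom.comp_apply, toSeriesGen_comp, Ideal.map_pow] at h1
  have hle : I.map (toSeries k).toRingHom ≤ Ideal.span {(PowerSeries.X : E k)} := by
    rw [Ideal.map_le_iff_le_comap]
    intro a ha
    exact toSeries_mem_span_X k ((comap_rulingAtVertex k).le ha)
  have h2 := Ideal.pow_right_mono hle 3 h1
  rw [Ideal.span_singleton_pow, Ideal.mem_span_singleton, AlgHom.toRingHom_eq_coe, RingHom.coe_coe,
    toSeries_x, PowerSeries.X_pow_dvd_iff] at h2
  have h3 := h2 2 (by norm_num)
  rw [PowerSeries.coeff_C_mul, PowerSeries.coeff_X_pow, if_pos rfl, mul_one] at h3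
  exact (inv_ne_zero (tK_ne_zero k)) h3

end OrderTwoAtRuling

/-- CONSEQUENCE FOR ANY ORDER-TYPE CLASS FUNCTION.  If `ι : (R : Type) → [CommRing R] → R → Ordinal` AGREES WITH THE
`𝔪`-ADIC ORDER WHEREVER THAT ORDER IS FINITE — `g ∈ 𝔪ⁿ`, `g ∉ 𝔪ⁿ⁺¹` `⇒ ι R g = n` at every local ring `R` (any junk
elsewhere; e.g. ORDER (o11)'s `iotaOrd`) — then the ALL-RINGS form of the generization clause («`ι (S_𝔭) f ≤ ι S f`
for ALL commutative rings `S`»: the first typing of (c7), `eft_sketch_v5.lean`, written out below) fails: witness the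
quadric cone over `ℚ`, `S = A_𝔪`, `𝔭 = 𝔭·A_𝔪`, `f = x`, where `ι (S_𝔭) f = 2 > 1 = ι S f`.  The tree's clause
`IotaGenerizationMonotone` (regular local `S` only) is not touched by this specimen. -/
theorem not_generizationMonotone_of_orderLike
    (ι : (R : Type) → [CommRing R] → R → Ordinal.{0})
    (hord : ∀ (R : Type) [CommRing R] [IsLocalRing R] (g : R) (n : ℕ),
      g ∈ (maximalIdeal R) ^ n → g ∉ (maximalIdeal R) ^ (n + 1) → ι R g = n) :
    ¬ (∀ (S : Type) [CommRing S] (𝔭 : Ideal S) [𝔭.IsPrime] (f : S),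
        ι (Localization.AtPrime 𝔭) (algebraMap S (Localization.AtPrime 𝔭) f) ≤ ι S f) := by
  intro hmono
  have h2 : ι (Localization.AtPrime (rulingAtVertex ℚ))
      (algebraMap (VertexLocalRing ℚ) (Localization.AtPrime (rulingAtVertex ℚ))
        (algebraMap (ConeRing ℚ) (VertexLocalRing ℚ) (x ℚ))) = (2 : ℕ) :=
    hord _ _ 2 (x_mem_sq_atRulingAtVertex ℚ) (x_not_mem_cube_atRulingAtVertex ℚ)
  have h1 : ι (VertexLocalRing ℚ) (algebraMap (ConeRing ℚ) (VertexLocalRing ℚ) (x ℚ)) = (1 : ℕ) :=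
    hord _ _ 1 (by simpa only [pow_one] using x_mem_maximalIdeal_atVertexLocalRing ℚ)
      (x_not_mem_sq_atVertexLocalRing ℚ)
  have h := hmono (VertexLocalRing ℚ) (rulingAtVertex ℚ) (algebraMap (ConeRing ℚ) (VertexLocalRing ℚ) (x ℚ))
  rw [h2, h1] at h
  exact absurd (Nat.cast_le.mp h) (by norm_num)


/-- `ord(x) = 2` EXACTLY at the generization `(A_𝔪)_{𝔭'} = A_𝔭`, read through ORDER (o11)'s `iotaOrd`. -/
theorem iotaOrd_x_atRulingAtVertex :
    iotaOrd (Localization.AtPrime (rulingAtVertex k))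
      (algebraMap (VertexLocalRing k) (Localization.AtPrime (rulingAtVertex k))
        (algebraMap (ConeRing k) (VertexLocalRing k) (x k))) = 2 := by
  exact_mod_cast (iotaOrd_eq_natCast_iff _ _ 2).mpr
    ⟨x_mem_sq_atRulingAtVertex k, x_not_mem_cube_atRulingAtVertex k⟩

end Summit.ResolutionOfSingularities.ResolutionOfSingularities.Cruxes.HypersurfaceCentreConstruction.LocalEngine.ConeSpecimen

end
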